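/-
Copyright (c) 2026 the pub-hodgecm-mathlib formalisation cell (harness21).  Prover seat hodgecm-mathlib-K2E1-p12 (g7), Track B ∕ R90-TF, h413 = `stmt-HodgeConjecture-24833`,
R90-TF section S8 «ContSpec-n½», socket (E) :276, E1-PLANCHEREL BODY bricks PB-2b + PB-2c (S8 dealer R90-CS-plan (g4) S8-R254 (8)+(13), S8-R263 (1)): the GRAM ASSEMBLY — the
shifted two-term formula of ★ PB-2a′ `K2E1PseudoEisensteinContourShiftVectorAxisGeneric` (axis `Re z = κ`) rewritten as the two-term Gram letter `hGram` of ★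
`K2E1PseudoEisensteinPlancherelIsometryOperator.exists_linearIsometry_of_twoTerm_gram` (residue block = a Gram in `⊕_{c∈S} W` for positive residue operators `R_c = B_c†B_c`; axis
term in the `A(t) = Ψ̂(−(κ+it))` currency), and the resulting `⊕`-isometry — pure linear algebra, on letters.
-/
import Summits.HodgeConjecture.HodgeConjecture.Theorems.K2E1PseudoEisensteinPlancherelIsometryOperator   -- ★ D4′c (SD) part 1 (K2E4-p10): `axisPairing_eq_setIntegral_Ioi_op`, `exists_linearIsometry_of_twoTerm_gram` (axis-free); brings ★ A `conj_vertical`, ★ P3a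
import Mathlib.Analysis.InnerProductSpace.PiL2
import HarnessLib

/-!
# PB-2b∕2c — `K2E1PseudoEisensteinTwoTermGramAxisGeneric`: from the contour-shifted two-term inner-product formula on the axis `Re z = κ` to the two-term GRAM LETTER
# `⟪x_i, x_j⟫ = ⟪r_i, r_j⟫_{M₁} + κ₀·∫_ℝ (⟪A_i(t), A_j(t)⟫ + ⟪A_i(−t), c(t)A_j(t)⟫) dt` and the Plancherel `⊕`-isometry (pure linear algebra, on letters)

Track B ∕ R90-TF, crux h413 = `stmt-HodgeConjecture-24833`, route of record `HCCMUnconditional`; cell `hodgecm-mathlib`, R90-TF programme, section S8 «ContSpec-n½», socket (E)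
(B ED. 7 :276): the E1-PLANCHEREL BODY at the τ-cut block, bricks PB-1…PB-4 (S8-R254; joint census `R90/S8/CENSUS-PlancherelBody-bricks.K2E1-p16-F0P2-p10.md`).  THIS FILE = PB-2b
(axis term) + PB-2c (residue block): the bookkeeping between ★ PB-2a′'s OUTPUT and PB-3∕PB-4's INPUT `hG`.  THEOREMS ONLY (no `def`, no `instance`, no `notation`, no named-fact
hypothesis, no `sorry`; default heartbeats); lane `--supports stmt-HodgeConjecture-24833 --as helper` (count-neutral).  No automorphic object.  CLOSES NO SOCKET.

THE MATHEMATICS ([MoeglinWaldspurger1995, II.2.4, IV.1.11, IV.3.12]; [Langlands1976, §7]; [ReedSimonI1980, Thm. I.7]).  Index the τ-cut wave packets by `i ∈ ι` (classes `x_i = [θ_{Ψ_i}]`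
in a Hilbert space `H`, vector transforms `Φ_i = Ψ̂_i : ℂ → V`).  ★ PB-2a′ (`U(2,1)`: `κ = 1`) gives for every pair, with Mathlib's convention `⟪u, v⟫_{L²} = ∫ conj u · v` (so
`∫_X θ_j·conj θ_i = ⟪x_i, x_j⟫`, the primed datum sits in the FIRST slot):
`⟪x_i, x_j⟫ = C·(Σ_{c∈S} ⟪Φ_i(−c), R_c Φ_j(−c)⟫_V) + C·((2π)⁻¹·∫_ℝ (⟪Φ_i(−z), Φ_j(−z)⟫ + ⟪Φ_i(−z̄), M(z)Φ_j(−z)⟫)|_{z=κ+iy} dy)` (**hIP**, `C ≥ 0`).  (PB-2c) If every residue operator is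
POSITIVE in the form `⟪u, R_c v⟫ = ⟪B_c u, B_c v⟫_W` (**hR**: `R_c = B_c†B_c` — at the top pole `z = 2` the `B_c` are the residue maps onto the characters `Θ∘det`, at `z = 3∕2` onto the
residual representations `π_ξ`; the inner product of residues IS the residue of the inner product, [MW IV.3.12], [Langlands1976 §7]), then the residue block is the Gram
`⟪r_i, r_j⟫` of the RESIDUE COORDINATES `r_i = (√C·B_c Φ_i(−c))_{c∈S} ∈ M₁ := ⊕_{c∈S} W` (an `ℓ²`-product, Mathlib `PiLp 2`) — §1.  (PB-2b) Since `−z̄ = −(κ + i(−y))` on the axis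
(★ A `conj_vertical`), the axis term is `κ₀·∫_ℝ (⟪A_i(t), A_j(t)⟫ + ⟪A_i(−t), c(t)A_j(t)⟫) dt` with `A_i(t) = Φ_i(−(κ+it))`, `c(t) = M(κ+it)`, `κ₀ = C·(2π)⁻¹ ≥ 0` — §2.  Together
(§3 HEAD) **`twoTerm_gram_of_contourShift`**: the `hGram` letter of ★ `exists_linearIsometry_of_twoTerm_gram` VERBATIM; and (§3) **`exists_linearIsometry_of_contourShift`**: under
axis unitarity **(hc1)** `⟪M(κ+it)u, M(κ+it)v⟫ = ⟪u, v⟫` and adjoint-reflection symmetry **(hcs)** `⟪u, M(κ+it)v⟫ = ⟪M(κ−it)u, v⟫` (the functional equation `M(2κ−z)M(z) = 1` ∘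
`M(z̄)† = M(z)` on the unitary axis) and integrability of the axis integrands, a LINEAR ISOMETRY `U : closure span {x_i} →ₗᵢ M₁ ⊕₂ L²((0,∞); V)`, `U x_i = (r_i, √κ₀•w_i)`,
`w_i =ᵐ A_i(t) + M(κ−it)A_i(−t)` — the block is (residues) ⊕ (continuous Mellin model): the `hG`∕model input of PB-3 (`modelMap`, `hUΛ`) and PB-4 (`hC`).
* §1 (PB-2c) `inner_residueCoord`, **`residueBlock_eq_inner_residueCoord`**.  * §2 (PB-2b) `axisIntegrand_eq_currency`, **`axisTerm_eq_currency`**.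
* §3 HEADS **`twoTerm_gram_of_contourShift`**, **`exists_linearIsometry_of_contourShift`** (+ `range` via ★ `range_linearIsometry_of_twoTerm_gram`, by name, not restated).
HONEST LABEL: HC_CM is proved only modulo the 7 printed citations (2 remaining named inputs: hLiu418 = `stmt-HodgeConjecture-24832`, h413 = `stmt-HodgeConjecture-24833`) until rung 0
closes; this file asserts no named fact, closes no socket; count-neutral; letters at instantiation (NOT paid here): `hIP` (= ★ PB-2a′'s conclusion, itself on the entry letters
`hs∕hr∕hB` + PB-1's formula), `hR` (positivity∕factorisation of the residue operators), `hc1`∕`hcs` (axis unitarity of `M(w₀, 1+it)|_V`), `hG` integrability, `hw` representatives.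

## References
* [MoeglinWaldspurger1995] C. Mœglin, J.-L. Waldspurger, *Spectral decomposition and Eisenstein series* (1995), II.2.4, IV.1.11, IV.3.12.
* [Langlands1976] R. P. Langlands, *On the Functional Equations Satisfied by Eisenstein Series*, LNM 544 (1976), §7.
* [ReedSimonI1980] M. Reed, B. Simon, *Methods of Modern Mathematical Physics I* (1980), Thm. I.7.
-/

set_option autoImplicit false
set_option linter.dupNamespace false  -- the mandated namespace repeats the summit's segment (`HodgeConjecture.HodgeConjecture`)

noncomputable section

open MeasureTheory Measure Set Filter Topology Complex
open scoped Real ComplexConjugate InnerProductSpace BigOperators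
open Summit.HodgeConjecture.HodgeConjecture.Cruxes.H413.K2E1MellinPaleyWienerHalfLine (conj_vertical)
open Summit.HodgeConjecture.HodgeConjecture.Cruxes.H413.K2E1PlancherelIsometryOfForm (mem_topologicalClosure_span)
open Summit.HodgeConjecture.HodgeConjecture.Cruxes.H413.K2E1PseudoEisensteinPlancherelIsometryOperator (exists_linearIsometry_of_twoTerm_gram)

namespace Summit.HodgeConjecture.HodgeConjecture.Cruxes.H413.K2E1PseudoEisensteinTwoTermGramAxisGeneric

variable {V : Type*} [NormedAddCommGroup V] [InnerProductSpace ℂ V] {W : Type*} [NormedAddCommGroup W] [InnerProductSpace ℂ W] {ι : Type*}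

/-! ## §1 (PB-2c) The residue block as the Gram of the residue coordinates in `M₁ = ⊕_{c∈S} W` -/

/-- **THE INNER PRODUCT OF TWO RESIDUE-COORDINATE VECTORS** in `M₁ = ⊕_{c ∈ S} W` (`ℓ²`-product): for `r_i = (√C·B_c Φ_i(−c))_{c∈S}`,
`⟪r_i, r_j⟫ = C·Σ_{c∈S} ⟪B_c Φ_i(−c), B_c Φ_j(−c)⟫_W` (`C ≥ 0`; Mathlib `PiLp.inner_apply` (definitional), `Finset.sum_coe_sort`). [folklore] -/
theorem inner_residueCoord (S : Finset ℝ) (B : ℝ → V →ₗ[ℂ] W) (Φ : ι → ℂ → V) {C : ℝ} (hC : 0 ≤ C) (i j : ι) :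
    ⟪(WithLp.toLp 2 fun c : ↥S => ((Real.sqrt C : ℝ) : ℂ) • B (c : ℝ) (Φ i (-((c : ℝ) : ℂ))) : PiLp 2 fun _ : ↥S => W),
        (WithLp.toLp 2 fun c : ↥S => ((Real.sqrt C : ℝ) : ℂ) • B (c : ℝ) (Φ j (-((c : ℝ) : ℂ))) : PiLp 2 fun _ : ↥S => W)⟫_ℂ =
      (C : ℂ) * ∑ c ∈ S, ⟪B c (Φ i (-(c : ℂ))), B c (Φ j (-(c : ℂ)))⟫_ℂ := by
  have hκ2 : ((Real.sqrt C : ℝ) : ℂ) * ((Real.sqrt C : ℝ) : ℂ) = (C : ℂ) := by rw [← ofReal_mul, Real.mul_self_sqrt hC]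
  rw [PiLp.inner_apply]
  simp only [inner_smul_left, inner_smul_right, conj_ofReal, ← mul_assoc, hκ2]
  rw [← Finset.mul_sum, Finset.sum_coe_sort S (fun c : ℝ => ⟪B c (Φ i (-(c : ℂ))), B c (Φ j (-(c : ℂ)))⟫_ℂ)]

/-- **PB-2c — THE RESIDUE BLOCK IS THE GRAM OF THE RESIDUE COORDINATES**: if every residue operator is positive in the form `⟪u, R_c v⟫ = ⟪B_c u, B_c v⟫_W` (`c ∈ S`), then
`C·Σ_{c∈S} ⟪Φ_i(−c), R_c Φ_j(−c)⟫_V = ⟪r_i, r_j⟫_{M₁}` with `r_i = (√C·B_c Φ_i(−c))_{c∈S} ∈ ⊕_{c∈S} W`. [cite: MoeglinWaldspurger1995, IV.3.12] [cite: Langlands1976, §7] -/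
theorem residueBlock_eq_inner_residueCoord (S : Finset ℝ) (R : ℝ → V →ₗ[ℂ] V) (B : ℝ → V →ₗ[ℂ] W) (hR : ∀ c ∈ S, ∀ u v : V, ⟪u, R c v⟫_ℂ = ⟪B c u, B c v⟫_ℂ)
    (Φ : ι → ℂ → V) {C : ℝ} (hC : 0 ≤ C) (i j : ι) :
    (C : ℂ) * ∑ c ∈ S, ⟪Φ i (-(c : ℂ)), R c (Φ j (-(c : ℂ)))⟫_ℂ =
      ⟪(WithLp.toLp 2 fun c : ↥S => ((Real.sqrt C : ℝ) : ℂ) • B (c : ℝ) (Φ i (-((c : ℝ) : ℂ))) : PiLp 2 fun _ : ↥S => W),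
        (WithLp.toLp 2 fun c : ↥S => ((Real.sqrt C : ℝ) : ℂ) • B (c : ℝ) (Φ j (-((c : ℝ) : ℂ))) : PiLp 2 fun _ : ↥S => W)⟫_ℂ := by
  rw [inner_residueCoord S B Φ hC i j]
  congr 1
  exact Finset.sum_congr rfl fun c hc => hR c hc _ _

/-! ## §2 (PB-2b) The axis term in the `A(t) = Φ(−(κ+it))`, `c(t) = M(κ+it)` currency -/

/-- On the axis `z = κ+iy`: `⟪Φ_i(−z), Φ_j(−z)⟫ + ⟪Φ_i(−z̄), M(z)Φ_j(−z)⟫ = ⟪A_i(y), A_j(y)⟫ + ⟪A_i(−y), c(y)A_j(y)⟫` with `A_i(t) = Φ_i(−(κ+it))`, `c(t) = M(κ+it)` (`z̄ = κ + i(−y)`,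
★ A `conj_vertical`; the κ-twin of ★ `axis_integrand_eq_op`). [folklore] -/
theorem axisIntegrand_eq_currency (Φ : ι → ℂ → V) (M : ℂ → V →ₗ[ℂ] V) (κ y : ℝ) (i j : ι) :
    ⟪Φ i (-((κ : ℂ) + y * I)), Φ j (-((κ : ℂ) + y * I))⟫_ℂ + ⟪Φ i (-conj ((κ : ℂ) + y * I)), M ((κ : ℂ) + y * I) (Φ j (-((κ : ℂ) + y * I)))⟫_ℂ =
      ⟪Φ i (-((κ : ℂ) + y * I)), Φ j (-((κ : ℂ) + y * I))⟫_ℂ + ⟪Φ i (-((κ : ℂ) + ((-y : ℝ) : ℂ) * I)), M ((κ : ℂ) + y * I) (Φ j (-((κ : ℂ) + y * I)))⟫_ℂ := by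
  rw [conj_vertical]

/-- **PB-2b — THE AXIS TERM IN ★ `exists_linearIsometry_of_twoTerm_gram`'s CURRENCY**: `C·((2π)⁻¹·∫_ℝ (⟪Φ_i(−z), Φ_j(−z)⟫ + ⟪Φ_i(−z̄), M(z)Φ_j(−z)⟫)|_{z=κ+iy} dy) =
κ₀·∫_ℝ (⟪A_i(t), A_j(t)⟫ + ⟪A_i(−t), c(t)A_j(t)⟫) dt`, `κ₀ = C·(2π)⁻¹`. [cite: MoeglinWaldspurger1995, IV.1.11] -/
theorem axisTerm_eq_currency (Φ : ι → ℂ → V) (M : ℂ → V →ₗ[ℂ] V) (κ : ℝ) (C : ℝ) (i j : ι) :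
    (C : ℂ) * ((((2 * π)⁻¹ : ℝ) : ℂ) * ∫ y : ℝ, (⟪Φ i (-((κ : ℂ) + y * I)), Φ j (-((κ : ℂ) + y * I))⟫_ℂ +
        ⟪Φ i (-conj ((κ : ℂ) + y * I)), M ((κ : ℂ) + y * I) (Φ j (-((κ : ℂ) + y * I)))⟫_ℂ)) =
      ((C * (2 * π)⁻¹ : ℝ) : ℂ) * ∫ t : ℝ, (⟪Φ i (-((κ : ℂ) + t * I)), Φ j (-((κ : ℂ) + t * I))⟫_ℂ +
        ⟪Φ i (-((κ : ℂ) + ((-t : ℝ) : ℂ) * I)), M ((κ : ℂ) + t * I) (Φ j (-((κ : ℂ) + t * I)))⟫_ℂ) := by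
  simp_rw [axisIntegrand_eq_currency]
  push_cast
  ring

/-! ## §3 HEADS: the two-term Gram letter and the `⊕`-isometry -/

/-- **HEAD (PB-2b + PB-2c) — THE TWO-TERM GRAM LETTER FROM THE CONTOUR-SHIFTED FORMULA.**  Data: a family `x : ι → H` in a complex inner-product space (the τ-cut wave-packet classes),
vector transforms `Φ_i : ℂ → V`, the continued operator datum `M : ℂ → End V`, a finset `S` of real poles with residue operators `R_c` POSITIVE in the form **(hR)** `⟪u, R_c v⟫ = ⟪B_c u, B_c v⟫_W`
(`c ∈ S`), a constant `C ≥ 0`, the axis `κ`, and the SHIFTED TWO-TERM FORMULA for every pair **(hIP)** (★ PB-2a′ `pseudoEisenstein_contourShift_vector_axis_of_letters` ∕ `…_cm_three`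
with `IP := ⟪x_i, x_j⟫`, `Ψ̂′ := Φ_i`, `Ψ̂ := Φ_j`): `⟪x_i, x_j⟫ = C·(Σ_{c∈S} ⟪Φ_i(−c), R_c Φ_j(−c)⟫) + C·((2π)⁻¹·∫_ℝ (⟪Φ_i(−z), Φ_j(−z)⟫ + ⟪Φ_i(−z̄), M(z)Φ_j(−z)⟫)|_{z=κ+iy} dy)`.  CONCLUSION
(the `hGram` of ★ `exists_linearIsometry_of_twoTerm_gram`, verbatim): **`⟪x_i, x_j⟫ = ⟪r_i, r_j⟫_{M₁} + κ₀·∫_ℝ (⟪A_i(t), A_j(t)⟫ + ⟪A_i(−t), c(t)A_j(t)⟫) dt`** with `M₁ = ⊕_{c∈S} W`,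
`r_i = (√C·B_c Φ_i(−c))_c`, `A_i(t) = Φ_i(−(κ+it))`, `c(t) = M(κ+it)`, `κ₀ = C·(2π)⁻¹`. [cite: MoeglinWaldspurger1995, II.2.4, IV.3.12] [cite: Langlands1976, §7] -/
theorem twoTerm_gram_of_contourShift {H : Type*} [NormedAddCommGroup H] [InnerProductSpace ℂ H] (x : ι → H) (Φ : ι → ℂ → V) (M : ℂ → V →ₗ[ℂ] V)
    (S : Finset ℝ) (R : ℝ → V →ₗ[ℂ] V) (B : ℝ → V →ₗ[ℂ] W) (hR : ∀ c ∈ S, ∀ u v : V, ⟪u, R c v⟫_ℂ = ⟪B c u, B c v⟫_ℂ) {C : ℝ} (hC : 0 ≤ C) (κ : ℝ)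
    (hIP : ∀ i j, ⟪x i, x j⟫_ℂ = (C : ℂ) * (∑ c ∈ S, ⟪Φ i (-(c : ℂ)), R c (Φ j (-(c : ℂ)))⟫_ℂ) +
      (C : ℂ) * ((((2 * π)⁻¹ : ℝ) : ℂ) * ∫ y : ℝ, (⟪Φ i (-((κ : ℂ) + y * I)), Φ j (-((κ : ℂ) + y * I))⟫_ℂ +
        ⟪Φ i (-conj ((κ : ℂ) + y * I)), M ((κ : ℂ) + y * I) (Φ j (-((κ : ℂ) + y * I)))⟫_ℂ))) (i j : ι) :
    ⟪x i, x j⟫_ℂ =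
      ⟪(WithLp.toLp 2 fun c : ↥S => ((Real.sqrt C : ℝ) : ℂ) • B (c : ℝ) (Φ i (-((c : ℝ) : ℂ))) : PiLp 2 fun _ : ↥S => W),
          (WithLp.toLp 2 fun c : ↥S => ((Real.sqrt C : ℝ) : ℂ) • B (c : ℝ) (Φ j (-((c : ℝ) : ℂ))) : PiLp 2 fun _ : ↥S => W)⟫_ℂ +
        ((C * (2 * π)⁻¹ : ℝ) : ℂ) * ∫ t : ℝ, (⟪Φ i (-((κ : ℂ) + t * I)), Φ j (-((κ : ℂ) + t * I))⟫_ℂ +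
          ⟪Φ i (-((κ : ℂ) + ((-t : ℝ) : ℂ) * I)), M ((κ : ℂ) + t * I) (Φ j (-((κ : ℂ) + t * I)))⟫_ℂ) := by
  rw [hIP i j, residueBlock_eq_inner_residueCoord S R B hR Φ hC i j, axisTerm_eq_currency Φ M κ C i j]

/-- **HEAD — THE PLANCHEREL `⊕`-ISOMETRY OF THE BLOCK FROM THE CONTOUR-SHIFTED FORMULA.**  With the data of `twoTerm_gram_of_contourShift` (`V`, `W` complete), the axis operators
UNITARY **(hc1)** `⟪M(κ+it)u, M(κ+it)v⟫ = ⟪u, v⟫` and ADJOINT-REFLECTION-SYMMETRIC **(hcs)** `⟪u, M(κ+it)v⟫ = ⟪M(κ−it)u, v⟫` (spelled `M(κ + i(−t))`), the axis integrands integrable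
**(hG)**, and `L²((0,∞); V)` representatives **(hw)** `w_i =ᵐ A_i(t) + M(κ−it)A_i(−t)`: there is a LINEAR ISOMETRY **`U : closure span {x_i} →ₗᵢ[ℂ] M₁ ⊕₂ L²((0,∞); V)`,
`U x_i = (r_i, √κ₀ • w_i)`**, `M₁ = ⊕_{c∈S} W`, `κ₀ = C·(2π)⁻¹` (★ `exists_linearIsometry_of_twoTerm_gram` on §3's `hGram`; its range is `closure span {(r_i, √κ₀•w_i)}` by ★
`range_linearIsometry_of_twoTerm_gram`, cited by name).  This is the (residues) ⊕ (continuous Mellin model) decomposition of the τ-cut block — PB-3's `modelMap` input.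
[cite: MoeglinWaldspurger1995, II.2.4, IV.3.12] [cite: ReedSimonI1980, Thm. I.7] -/
theorem exists_linearIsometry_of_contourShift [CompleteSpace V] [CompleteSpace W] {H : Type*} [NormedAddCommGroup H] [InnerProductSpace ℂ H]
    (x : ι → H) (Φ : ι → ℂ → V) (M : ℂ → V →ₗ[ℂ] V)
    (S : Finset ℝ) (R : ℝ → V →ₗ[ℂ] V) (B : ℝ → V →ₗ[ℂ] W) (hR : ∀ c ∈ S, ∀ u v : V, ⟪u, R c v⟫_ℂ = ⟪B c u, B c v⟫_ℂ) {C : ℝ} (hC : 0 ≤ C) (κ : ℝ)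
    (hIP : ∀ i j, ⟪x i, x j⟫_ℂ = (C : ℂ) * (∑ c ∈ S, ⟪Φ i (-(c : ℂ)), R c (Φ j (-(c : ℂ)))⟫_ℂ) +
      (C : ℂ) * ((((2 * π)⁻¹ : ℝ) : ℂ) * ∫ y : ℝ, (⟪Φ i (-((κ : ℂ) + y * I)), Φ j (-((κ : ℂ) + y * I))⟫_ℂ +
        ⟪Φ i (-conj ((κ : ℂ) + y * I)), M ((κ : ℂ) + y * I) (Φ j (-((κ : ℂ) + y * I)))⟫_ℂ)))
    (hc1 : ∀ (t : ℝ) (u v : V), ⟪M ((κ : ℂ) + t * I) u, M ((κ : ℂ) + t * I) v⟫_ℂ = ⟪u, v⟫_ℂ)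
    (hcs : ∀ (t : ℝ) (u v : V), ⟪u, M ((κ : ℂ) + t * I) v⟫_ℂ = ⟪M ((κ : ℂ) + ((-t : ℝ) : ℂ) * I) u, v⟫_ℂ)
    (hG : ∀ i j, Integrable fun t : ℝ => ⟪Φ i (-((κ : ℂ) + t * I)), Φ j (-((κ : ℂ) + t * I))⟫_ℂ +
      ⟪Φ i (-((κ : ℂ) + ((-t : ℝ) : ℂ) * I)), M ((κ : ℂ) + t * I) (Φ j (-((κ : ℂ) + t * I)))⟫_ℂ)
    (w : ι → Lp V 2 ((volume : Measure ℝ).restrict (Ioi 0)))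
    (hw : ∀ i, (w i : ℝ → V) =ᵐ[(volume : Measure ℝ).restrict (Ioi 0)] fun t => Φ i (-((κ : ℂ) + t * I)) + M ((κ : ℂ) + ((-t : ℝ) : ℂ) * I) (Φ i (-((κ : ℂ) + ((-t : ℝ) : ℂ) * I)))) :
    ∃ U : (Submodule.span ℂ (Set.range x)).topologicalClosure →ₗᵢ[ℂ] WithLp 2 ((PiLp 2 fun _ : ↥S => W) × Lp V 2 ((volume : Measure ℝ).restrict (Ioi 0))),
      ∀ i, U ⟨x i, mem_topologicalClosure_span x i⟩ =
        WithLp.toLp 2 ((WithLp.toLp 2 fun c : ↥S => ((Real.sqrt C : ℝ) : ℂ) • B (c : ℝ) (Φ i (-((c : ℝ) : ℂ))) : PiLp 2 fun _ : ↥S => W),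
          ((Real.sqrt (C * (2 * π)⁻¹) : ℝ) : ℂ) • w i) := by
  have hκ₀ : 0 ≤ C * (2 * π)⁻¹ := mul_nonneg hC (inv_nonneg.2 (by positivity))
  have hGram := twoTerm_gram_of_contourShift x Φ M S R B hR hC κ hIP
  -- the axis currency `A_i(t) = Φ_i(−(κ+it))`, `c(t) = M(κ+it)` (so `c(−t) = M(κ + i(−t))`, the spelling of `hcs`, `hG`, `hw`)
  exact exists_linearIsometry_of_twoTerm_gram (V := V) x
    (fun i => (WithLp.toLp 2 fun c : ↥S => ((Real.sqrt C : ℝ) : ℂ) • B (c : ℝ) (Φ i (-((c : ℝ) : ℂ))) : PiLp 2 fun _ : ↥S => W))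
    (fun i t => Φ i (-((κ : ℂ) + t * I))) (c := fun t => M ((κ : ℂ) + t * I)) hc1 hcs hκ₀ w hw hG hGram

/-! ## §4 (ED. 2) The junction to PB-3∕PB-4's `hG` bytes: the axis term as an inner product in `L²((0,∞); V)` -/

open Summit.HodgeConjecture.HodgeConjecture.Cruxes.H413.K2E1PseudoEisensteinPlancherelIsometryOperator (inner_eq_integral_inner axisPairing_eq_setIntegral_Ioi_op) in

/-- **ED. 2 — THE TWO-TERM GRAM LETTER IN `⟪r i, r j⟫ + ⟪c i, c j⟫` FORM (the `hG` bytes of ★ `R90S8PlancherelLineModelOfGram.exists_lineModelLetters_of_gram_residueGram`, K2E1-p16 PB-3∕PB-4,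
and of ★ P3a `exists_linearIsometry_of_inner_eq_add`).**  With the data of `twoTerm_gram_of_contourShift`, axis unitarity **(hc1)**, adjoint-reflection symmetry **(hcs)**, integrable
axis integrands **(hG)** and `L²((0,∞); V)` representatives **(hw)** `w_i =ᵐ A_i(t) + M(κ−it)A_i(−t)`: **`⟪x_i, x_j⟫ = ⟪r_i, r_j⟫_{M₁} + ⟪√κ₀•w_i, √κ₀•w_j⟫_{L²((0,∞);V)}`**, `M₁ = ⊕_{c∈S} W`,
`r_i = (√C·B_c Φ_i(−c))_c`, `κ₀ = C·(2π)⁻¹` — i.e. `c_i := √κ₀•w_i` is the continuous coordinate (§3 ∘ ★ `axisPairing_eq_setIntegral_Ioi_op` ∘ ★ `inner_eq_integral_inner`; the computation inside ★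
`exists_linearIsometry_of_twoTerm_gram`, exported as a statement). [cite: MoeglinWaldspurger1995, II.2.4, IV.3.12] [cite: Langlands1976, §7] -/
theorem twoTerm_gram_inner_Lp_of_contourShift {H : Type*} [NormedAddCommGroup H] [InnerProductSpace ℂ H]
    (x : ι → H) (Φ : ι → ℂ → V) (M : ℂ → V →ₗ[ℂ] V)
    (S : Finset ℝ) (R : ℝ → V →ₗ[ℂ] V) (B : ℝ → V →ₗ[ℂ] W) (hR : ∀ c ∈ S, ∀ u v : V, ⟪u, R c v⟫_ℂ = ⟪B c u, B c v⟫_ℂ) {C : ℝ} (hC : 0 ≤ C) (κ : ℝ)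
    (hIP : ∀ i j, ⟪x i, x j⟫_ℂ = (C : ℂ) * (∑ c ∈ S, ⟪Φ i (-(c : ℂ)), R c (Φ j (-(c : ℂ)))⟫_ℂ) +
      (C : ℂ) * ((((2 * π)⁻¹ : ℝ) : ℂ) * ∫ y : ℝ, (⟪Φ i (-((κ : ℂ) + y * I)), Φ j (-((κ : ℂ) + y * I))⟫_ℂ +
        ⟪Φ i (-conj ((κ : ℂ) + y * I)), M ((κ : ℂ) + y * I) (Φ j (-((κ : ℂ) + y * I)))⟫_ℂ)))
    (hc1 : ∀ (t : ℝ) (u v : V), ⟪M ((κ : ℂ) + t * I) u, M ((κ : ℂ) + t * I) v⟫_ℂ = ⟪u, v⟫_ℂ)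
    (hcs : ∀ (t : ℝ) (u v : V), ⟪u, M ((κ : ℂ) + t * I) v⟫_ℂ = ⟪M ((κ : ℂ) + ((-t : ℝ) : ℂ) * I) u, v⟫_ℂ)
    (hG : ∀ i j, Integrable fun t : ℝ => ⟪Φ i (-((κ : ℂ) + t * I)), Φ j (-((κ : ℂ) + t * I))⟫_ℂ +
      ⟪Φ i (-((κ : ℂ) + ((-t : ℝ) : ℂ) * I)), M ((κ : ℂ) + t * I) (Φ j (-((κ : ℂ) + t * I)))⟫_ℂ)
    (w : ι → Lp V 2 ((volume : Measure ℝ).restrict (Ioi 0)))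
    (hw : ∀ i, (w i : ℝ → V) =ᵐ[(volume : Measure ℝ).restrict (Ioi 0)] fun t => Φ i (-((κ : ℂ) + t * I)) + M ((κ : ℂ) + ((-t : ℝ) : ℂ) * I) (Φ i (-((κ : ℂ) + ((-t : ℝ) : ℂ) * I))))
    (i j : ι) :
    ⟪x i, x j⟫_ℂ =
      ⟪(WithLp.toLp 2 fun c : ↥S => ((Real.sqrt C : ℝ) : ℂ) • B (c : ℝ) (Φ i (-((c : ℝ) : ℂ))) : PiLp 2 fun _ : ↥S => W),
          (WithLp.toLp 2 fun c : ↥S => ((Real.sqrt C : ℝ) : ℂ) • B (c : ℝ) (Φ j (-((c : ℝ) : ℂ))) : PiLp 2 fun _ : ↥S => W)⟫_ℂ +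
        ⟪((Real.sqrt (C * (2 * π)⁻¹) : ℝ) : ℂ) • w i, ((Real.sqrt (C * (2 * π)⁻¹) : ℝ) : ℂ) • w j⟫_ℂ := by
  have hκ₀ : 0 ≤ C * (2 * π)⁻¹ := mul_nonneg hC (inv_nonneg.2 (by positivity))
  have hκ2 : ((Real.sqrt (C * (2 * π)⁻¹) : ℝ) : ℂ) * ((Real.sqrt (C * (2 * π)⁻¹) : ℝ) : ℂ) = ((C * (2 * π)⁻¹ : ℝ) : ℂ) := by
    rw [← ofReal_mul, Real.mul_self_sqrt hκ₀]
  -- the axis pairing as the `L²((0,∞);V)` inner product of the representatives (★ `inner_eq_integral_inner` ∘ ★ `axisPairing_eq_setIntegral_Ioi_op`, `A_i(t) = Φ_i(−(κ+it))`, `c(t) = M(κ+it)`)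
  have h4 : ⟪w i, w j⟫_ℂ = ∫ t in Ioi (0 : ℝ), ⟪Φ i (-((κ : ℂ) + t * I)) + M ((κ : ℂ) + ((-t : ℝ) : ℂ) * I) (Φ i (-((κ : ℂ) + ((-t : ℝ) : ℂ) * I))),
      Φ j (-((κ : ℂ) + t * I)) + M ((κ : ℂ) + ((-t : ℝ) : ℂ) * I) (Φ j (-((κ : ℂ) + ((-t : ℝ) : ℂ) * I)))⟫_ℂ := inner_eq_integral_inner (w i) (w j) (hw i) (hw j)
  have h5 := axisPairing_eq_setIntegral_Ioi_op (A := fun t : ℝ => Φ j (-((κ : ℂ) + t * I))) (A' := fun t : ℝ => Φ i (-((κ : ℂ) + t * I)))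
    (c := fun t : ℝ => M ((κ : ℂ) + t * I)) hc1 hcs (hG i j)
  rw [twoTerm_gram_of_contourShift x Φ M S R B hR hC κ hIP i j, inner_smul_left, inner_smul_right, conj_ofReal, ← mul_assoc, hκ2, h4, h5]

end Summit.HodgeConjecture.HodgeConjecture.Cruxes.H413.K2E1PseudoEisensteinTwoTermGramAxisGeneric

end
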